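import Summits.BirchSwinnertonDyer.BirchSwinnertonDyer.Theorems.GenusKolyvaginAtTwoMultiGenusPrimitivityAtTwoReducedGenusPoint
import Summits.BirchSwinnertonDyer.Rank1Residual.X11b.RingClassFieldConj
import Literature.NumberTheory.EllipticCurves.RingClassFieldConjugation

/-!
# Route `GenusKolyvaginAtTwo`, crux stmt-BirchSwinnertonDyer-24947 `MultiGenusPrimitivityAtTwo` (U): the reduced genus
# Heegner point DESCENDS TO THE AUXILIARY QUADRATIC FIELD `K_ℓ = ℚ(√ℓ*)`, and the certificate is its `2`-primitivity there

Lead prover seat bsd-line-gk2-p1 (g6); sequel to `…ReducedGenusPoint` (p608625). Kernel anchor of §2 of the crux memo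
`Cruxes/GenusPrimitiveSupplyAtTwo/Lines/genus-supply-local.md` («the K ↔ K_ℓ symmetry»).

Frame: the crux's (`W` globally minimal with `ρ̄_{E,2}` onto, `K` imaginary quadratic with odd `d_K ≠ −3`, Heegner
hypothesis), a Kolyvagin prime `ℓ` at `2` (square-free Kolyvagin level `n` for the general lemmas), a datum `d`, radicals
`θ_ℓ² = ℓ*`, `G` enumerating `𝒢 = Gal(K[n]/K)`, and an automorphism `τ ∈ Aut(K[n]/ℚ)` OUTSIDE `𝒢` — e.g. the restriction of
complex conjugation (`X11b.RingClassConj.exists_conj_algEquiv`, `conj_not_mem_ringClassGal`). By Cox's Lemma 9.3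
(`Literature.….mul_mul_inv_eq_inv_of_not_mem_ringClassGal`: `τ σ τ⁻¹ = σ⁻¹`) such a `τ` preserves every genus-character
(`χ_n`-isotypic) component of `E(K[n])` and `τ²` acts trivially on it (§1). Hence, in a `2`-torsion-free group, an isotypic
point `R` splits up to ODD torsion as `R = ½(R + τR) + ½(R − τR)`; if the `τ`-FIXED isotypic points are torsion — hypothesis
`hR0`; at a depth-2 prime `ℓ` with `τ` = complex conjugation this is «the `χ_ℓ`-points of `E` over the REAL quadratic field
`ℚ(√(ℓ|d_K|))` are torsion», i.e. `rank E^{(ℓ* d_K)}(ℚ) = 0`, the EVEN member of the genus pair, automatic (Gross–Zagier–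
Kolyvagin) whenever the genus point `Y_ℓ` is non-torsion — then some ODD multiple `m·R` is ANTI-fixed by `τ` (§2,
`heegner_isotypic_exists_odd_smul_conj_eq_neg`), hence FIXED by every automorphism of `K[ℓ]` fixing `θ_ℓ`
(`heegner_isotypic_exists_odd_smul_mem_auxField`): `m·R ∈ E(ℚ(θ_ℓ)) = E(K_ℓ)`, `K_ℓ = ℚ(√ℓ*)` the AUXILIARY quadratic field
(imaginary, `= ℚ(√−ℓ)`, at depth 2 where `ℓ ≡ 3 (mod 4)`). Applied to the reduced genus point `W_ℓ = Y_ℓ/2` and its halves: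
**the crux's certificate at a depth-2 Kolyvagin prime is EXACTLY «no odd multiple of `W_ℓ` is twice a `K_ℓ`-rational point of
`E(K[ℓ])`»** (`heegner_certificate_iff_forall_odd_not_two_dvd_in_auxField`) — a statement inside the rank-one `ℤ₂`-line
`E(K_ℓ) ⊗ ℤ₂ ≅ E^{(ℓ*)}(ℚ) ⊗ ℤ₂`, the same line that carries the LEVEL-ONE Heegner point of `E` over `K_ℓ` (memo §2; that
comparison is Gross–Zagier bookkeeping and is NOT asserted here). §3: complex conjugation moves `θ` to `−θ` whenever
`θ² = q < 0` (so at depth 2 the hypotheses `hτ`, `hτθ` are met by complex conjugation), and some `τ ∉ 𝒢` with `τθ_ℓ = −θ_ℓ`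
always exists. Helper (`--supports stmt-BirchSwinnertonDyer-24947`); nothing here is a named fact; BSD is not proved by any of this.

References: [GrossLMS1991] §3 (3.5), §4 (4.1), Lemma 4.3, §5 (τστ⁻¹ = σ⁻¹); [Cox2013] §9.A Lemma 9.3; [SilvermanAEC2009] X.2
Prop. 2.4 (proof).
-/

set_option linter.dupNamespace false -- tree convention: `Summit.BirchSwinnertonDyer.BirchSwinnertonDyer.Theorems` (summit = sub-problem)

noncomputable section

open scoped Classical

namespace Summit.BirchSwinnertonDyer.BirchSwinnertonDyer.Theorems.GenusKoly

open Finset NumberField WeierstrassCurve Literature.NumberTheory.EllipticCurves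
  Literature.NumberTheory.EllipticCurves.ModularForms

section Heegner

variable {W : WeierstrassCurve ℚ} [NeZero (W.conductorNorm ℤ)] {K : Type} [Field K] [NumberField K]
  {Dt : ModularParametrizationData W (W.conductorNorm ℤ)} {β : ℤ} {ι : K →+* ℂ}

/-! ### §1 An automorphism outside `Gal(K[n]/K)` preserves the genus-character components -/

omit [NeZero (W.conductorNorm ℤ)] in
/-- `(g·h)·P = g·(h·P)` for the coordinatewise action `pointGalHom`. [folklore] -/
theorem pointGalHom_mul_apply {n : ℕ} (g h : ringClassField K ι n ≃ₐ[ℚ] ringClassField K ι n)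
    (P : (W.baseChange (ringClassField K ι n)).toAffine.Point) :
    pointGalHom W (ringClassField K ι n) (g * h) P =
      pointGalHom W (ringClassField K ι n) g (pointGalHom W (ringClassField K ι n) h P) := by
  rw [map_mul]; rfl

/-- **The genus sign is inversion-invariant**: `g⁻¹θ = θ ↔ gθ = θ`. [cite: SilvermanAEC2009, X.2 Prop. 2.4 (proof)] -/
theorem heegner_inv_apply_theta_iff {n : ℕ} {θ : ℕ → ringClassField K ι n}
    (g : ringClassField K ι n ≃ₐ[ℚ] ringClassField K ι n) (ℓ : ℕ) : g⁻¹ (θ ℓ) = θ ℓ ↔ g (θ ℓ) = θ ℓ := by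
  constructor
  · intro h
    have h' := congrArg g h
    rw [← AlgEquiv.mul_apply, mul_inv_cancel, AlgEquiv.one_apply] at h'
    exact h'.symm
  · intro h
    have h' : g⁻¹ (g (θ ℓ)) = g⁻¹ (θ ℓ) := by rw [h]
    rw [← AlgEquiv.mul_apply, inv_mul_cancel, AlgEquiv.one_apply] at h'
    exact h'.symm

/-- `χ_n(g⁻¹) = χ_n(g)`. [cite: SilvermanAEC2009, X.2 Prop. 2.4 (proof)] -/
theorem heegner_genusSignProd_inv {n : ℕ} {θ : ℕ → ringClassField K ι n}
    (g : ringClassField K ι n ≃ₐ[ℚ] ringClassField K ι n) (P : Finset ℕ) :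
    (∏ ℓ ∈ P, (if g⁻¹ (θ ℓ) = θ ℓ then (1 : ℤ) else -1)) = ∏ ℓ ∈ P, (if g (θ ℓ) = θ ℓ then (1 : ℤ) else -1) := by
  refine Finset.prod_congr rfl fun ℓ _ ↦ ?_
  simp only [heegner_inv_apply_theta_iff g ℓ]

omit [NeZero (W.conductorNorm ℤ)] in
/-- **An automorphism `τ ∉ Gal(K[n]/K)` maps `χ_n`-isotypic points to `χ_n`-isotypic points**: if
`h·R = χ_n(h)·R` for all `h ∈ 𝒢_n` then `h·(τR) = χ_n(h)·(τR)` — because `hτ = τh⁻¹` (Cox Lemma 9.3 / Gross §5) and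
`χ_n(h⁻¹) = χ_n(h)`. [cite: Cox2013, §9.A Lemma 9.3] [cite: GrossLMS1991, §5 (proof of Prop. 5.4)] -/
theorem heegner_conj_isotypic (hK : IsImaginaryQuadratic K) {n : ℕ} (hn : n ≠ 0) {θ : ℕ → ringClassField K ι n}
    (P : Finset ℕ) {τ : ringClassField K ι n ≃ₐ[ℚ] ringClassField K ι n} (hτ : τ ∉ ringClassGal ι n)
    {R : (W.baseChange (ringClassField K ι n)).toAffine.Point}
    (hR : ∀ h ∈ ringClassGal ι n, pointGalHom W (ringClassField K ι n) h R =
      (∏ ℓ ∈ P, (if h (θ ℓ) = θ ℓ then (1 : ℤ) else -1)) • R) :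
    ∀ h ∈ ringClassGal ι n, pointGalHom W (ringClassField K ι n) h (pointGalHom W (ringClassField K ι n) τ R) =
      (∏ ℓ ∈ P, (if h (θ ℓ) = θ ℓ then (1 : ℤ) else -1)) • pointGalHom W (ringClassField K ι n) τ R := by
  intro h hh
  have hinv : h⁻¹ ∈ ringClassGal ι n := inv_mem hh
  -- `τ h⁻¹ τ⁻¹ = h`, i.e. `h τ = τ h⁻¹`
  have hdih := mul_mul_inv_eq_inv_of_not_mem_ringClassGal hK ι hn hτ hinv
  rw [inv_inv, mul_inv_eq_iff_eq_mul] at hdih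
  rw [← pointGalHom_mul_apply, ← hdih, pointGalHom_mul_apply, hR _ hinv, map_zsmul, heegner_genusSignProd_inv]

/-- `τ² ∈ Gal(K[n]/K)` for every `τ ∈ Aut(K[n]/ℚ)` (the subgroup has index `≤ 2`). [cite: Cox2013, §9.A Lemma 9.3] -/
theorem heegner_conj_mul_self_mem (hK : IsImaginaryQuadratic K) (n : ℕ)
    (τ : ringClassField K ι n ≃ₐ[ℚ] ringClassField K ι n) : τ * τ ∈ ringClassGal ι n := by
  by_cases hτ : τ ∈ ringClassGal ι n
  · exact mul_mem hτ hτ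
  · have hτ' : τ⁻¹ ∉ ringClassGal ι n := fun h ↦ hτ (by simpa using inv_mem h)
    simpa using inv_mul_mem_ringClassGal_of_not_mem hK ι n hτ' hτ

/-- `τ²` fixes every radical `θ_ℓ` (`τθ_ℓ = ±θ_ℓ`). [cite: SilvermanAEC2009, X.2 Prop. 2.4 (proof)] -/
theorem heegner_conj_mul_self_apply_theta {n : ℕ} {θ : ℕ → ringClassField K ι n}
    (hθ : ∀ ℓ ∈ n.primeFactors, θ ℓ ^ 2 = algebraMap ℚ (ringClassField K ι n) ((-1 : ℚ) ^ (ℓ / 2) * ℓ))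
    (τ : ringClassField K ι n ≃ₐ[ℚ] ringClassField K ι n) {ℓ : ℕ} (hℓ : ℓ ∈ n.primeFactors) :
    (τ * τ) (θ ℓ) = θ ℓ := by
  rw [AlgEquiv.mul_apply]
  rcases algEquiv_apply_eq_or_eq_neg_of_sq_eq (hθ ℓ hℓ) τ with h | h
  · rw [h, h]
  · rw [h, map_neg, h, neg_neg]

omit [NeZero (W.conductorNorm ℤ)] in
/-- **`τ²` acts trivially on `χ_n`-isotypic points** (`τ² ∈ 𝒢_n` and `χ_n(τ²) = 1`). [cite: Cox2013, §9.A Lemma 9.3] -/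
theorem heegner_conj_conj_isotypic (hK : IsImaginaryQuadratic K) {n : ℕ} {θ : ℕ → ringClassField K ι n}
    (hθ : ∀ ℓ ∈ n.primeFactors, θ ℓ ^ 2 = algebraMap ℚ (ringClassField K ι n) ((-1 : ℚ) ^ (ℓ / 2) * ℓ))
    (τ : ringClassField K ι n ≃ₐ[ℚ] ringClassField K ι n)
    {R : (W.baseChange (ringClassField K ι n)).toAffine.Point}
    (hR : ∀ h ∈ ringClassGal ι n, pointGalHom W (ringClassField K ι n) h R =
      (∏ ℓ ∈ n.primeFactors, (if h (θ ℓ) = θ ℓ then (1 : ℤ) else -1)) • R) :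
    pointGalHom W (ringClassField K ι n) τ (pointGalHom W (ringClassField K ι n) τ R) = R := by
  rw [← pointGalHom_mul_apply, hR _ (heegner_conj_mul_self_mem hK n τ)]
  have h1 : (∏ ℓ ∈ n.primeFactors, (if (τ * τ) (θ ℓ) = θ ℓ then (1 : ℤ) else -1)) = 1 :=
    Finset.prod_eq_one fun ℓ hℓ ↦ by rw [if_pos (heegner_conj_mul_self_apply_theta hθ τ hℓ)]
  rw [h1, one_smul]

/-! ### §2 Descent of isotypic points to the auxiliary quadratic field, up to odd multiples -/

omit [NeZero (W.conductorNorm ℤ)] in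
/-- **Some ODD multiple of a `χ_n`-isotypic point is ANTI-fixed by `τ`**, provided the `τ`-FIXED isotypic points are torsion
(`hR0`: with `τ` = complex conjugation at a depth-2 level, «`E^{(n* d_K)}(ℚ)` has rank `0`», the even member of the genus
pair). Proof: `Z = R + τR` is isotypic and `τ`-fixed (`τ²R = R`), hence of finite order `2^k m`, `m` odd; `E(K[n])` has no
`2`-torsion on the crux's frame, so `mZ = 0` and `τ(mR) = −mR`.
[cite: GrossLMS1991, §4 Lemma 4.3, §5 (proof of Prop. 5.4)] [cite: Cox2013, §9.A Lemma 9.3] -/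
theorem heegner_isotypic_exists_odd_smul_conj_eq_neg [W.IsElliptic] [W.IsGloballyMinimal]
    (hK : IsImaginaryQuadratic K) (hodd : Odd (NumberField.discr K))
    (hH : SatisfiesHeegnerHypothesis (W.conductorNorm ℤ) K) (hsurj : W.HasSurjectiveModNGaloisRep ((2 : ℤ) ^ 1))
    {n : ℕ} (hn : n ≠ 0) {θ : ℕ → ringClassField K ι n}
    (hθ : ∀ ℓ ∈ n.primeFactors, θ ℓ ^ 2 = algebraMap ℚ (ringClassField K ι n) ((-1 : ℚ) ^ (ℓ / 2) * ℓ))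
    {τ : ringClassField K ι n ≃ₐ[ℚ] ringClassField K ι n} (hτ : τ ∉ ringClassGal ι n)
    (hR0 : ∀ S : (W.baseChange (ringClassField K ι n)).toAffine.Point,
      (∀ h ∈ ringClassGal ι n, pointGalHom W (ringClassField K ι n) h S =
        (∏ ℓ ∈ n.primeFactors, (if h (θ ℓ) = θ ℓ then (1 : ℤ) else -1)) • S) →
      pointGalHom W (ringClassField K ι n) τ S = S → IsOfFinAddOrder S)
    {R : (W.baseChange (ringClassField K ι n)).toAffine.Point}
    (hR : ∀ h ∈ ringClassGal ι n, pointGalHom W (ringClassField K ι n) h R =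
      (∏ ℓ ∈ n.primeFactors, (if h (θ ℓ) = θ ℓ then (1 : ℤ) else -1)) • R) :
    ∃ m : ℕ, Odd m ∧ pointGalHom W (ringClassField K ι n) τ ((m : ℤ) • R) = -((m : ℤ) • R) := by
  have htors := heegner_two_torsion_free (ι := ι) hK hodd hH hsurj hn
  set Z := R + pointGalHom W (ringClassField K ι n) τ R with hZ
  have hZiso : ∀ h ∈ ringClassGal ι n, pointGalHom W (ringClassField K ι n) h Z =
      (∏ ℓ ∈ n.primeFactors, (if h (θ ℓ) = θ ℓ then (1 : ℤ) else -1)) • Z := fun h hh ↦ by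
    rw [hZ, map_add, hR h hh, heegner_conj_isotypic hK hn n.primeFactors hτ hR h hh, smul_add]
  have hZfix : pointGalHom W (ringClassField K ι n) τ Z = Z := by
    rw [hZ, map_add, heegner_conj_conj_isotypic hK hθ τ hR, add_comm]
  obtain ⟨N, hNpos, hNZ⟩ := (isOfFinAddOrder_iff_nsmul_eq_zero).mp (hR0 Z hZiso hZfix)
  obtain ⟨k, m, hm, hNkm⟩ := Nat.exists_eq_two_pow_mul_odd hNpos.ne'
  refine ⟨m, hm, ?_⟩
  -- `2^k · (m · Z) = N · Z = 0`, hence `m · Z = 0`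
  have hmZ : (m : ℤ) • Z = 0 := by
    refine eq_zero_of_two_pow_smul_eq_zero htors k _ ?_
    have h2 : ((2 : ℤ) ^ k * (m : ℤ)) = ((N : ℕ) : ℤ) := by rw [hNkm]; push_cast; ring
    rw [smul_smul, h2, natCast_zsmul, hNZ]
  have hτR : pointGalHom W (ringClassField K ι n) τ R = Z - R := by rw [hZ]; abel
  rw [map_zsmul, hτR, smul_sub, sub_eq_neg_self, hmZ]

omit [NeZero (W.conductorNorm ℤ)] in
/-- **At prime level, the odd multiple lies in the AUXILIARY field `ℚ(θ_ℓ)`**: with `τθ_ℓ = −θ_ℓ` (e.g. complex conjugation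
at a depth-2 prime, §3), a `χ_ℓ`-isotypic point anti-fixed by `τ` is fixed by EVERY automorphism of `K[ℓ]` fixing `θ_ℓ`
(those are `ker χ_ℓ ∪ τ·(𝒢_ℓ ∖ ker χ_ℓ)`), i.e. it is a point of `E` over the fixed field `ℚ(θ_ℓ) = ℚ(√ℓ*)`.
[cite: Cox2013, §9.A Lemma 9.3] [cite: SilvermanAEC2009, X.2 Prop. 2.4 (proof)] -/
theorem heegner_isotypic_fixed_of_apply_theta_eq (hK : IsImaginaryQuadratic K) {ℓ : ℕ} (hℓ : ℓ.Prime)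
    {θ : ℕ → ringClassField K ι ℓ}
    (hθ : ∀ ℓ' ∈ ℓ.primeFactors, θ ℓ' ^ 2 = algebraMap ℚ (ringClassField K ι ℓ) ((-1 : ℚ) ^ (ℓ' / 2) * ℓ'))
    {τ : ringClassField K ι ℓ ≃ₐ[ℚ] ringClassField K ι ℓ} (hτ : τ ∉ ringClassGal ι ℓ) (hτθ : τ (θ ℓ) = -θ ℓ)
    {S : (W.baseChange (ringClassField K ι ℓ)).toAffine.Point}
    (hS : ∀ h ∈ ringClassGal ι ℓ, pointGalHom W (ringClassField K ι ℓ) h S =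
      (∏ ℓ' ∈ ℓ.primeFactors, (if h (θ ℓ') = θ ℓ' then (1 : ℤ) else -1)) • S)
    (hSτ : pointGalHom W (ringClassField K ι ℓ) τ S = -S) :
    ∀ g : ringClassField K ι ℓ ≃ₐ[ℚ] ringClassField K ι ℓ, g (θ ℓ) = θ ℓ →
      pointGalHom W (ringClassField K ι ℓ) g S = S := by
  have hPF : ℓ.primeFactors = {ℓ} := Nat.Prime.primeFactors hℓ
  have hℓmem : ℓ ∈ ℓ.primeFactors := by rw [hPF]; exact Finset.mem_singleton_self ℓ
  have hθ0 : θ ℓ ≠ 0 := ne_zero_of_sq_eq_pStar hℓ (hθ ℓ hℓmem)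
  intro g hg
  by_cases hgm : g ∈ ringClassGal ι ℓ
  · rw [hS g hgm, hPF, Finset.prod_singleton, if_pos hg, one_smul]
  · -- `g = τ h` with `h ∈ 𝒢_ℓ`, and `hθ = −θ`
    have hh : τ⁻¹ * g ∈ ringClassGal ι ℓ := inv_mul_mem_ringClassGal_of_not_mem hK ι ℓ hτ hgm
    have hhθ : (τ⁻¹ * g) (θ ℓ) = -θ ℓ := by
      rcases algEquiv_apply_eq_or_eq_neg_of_sq_eq (hθ ℓ hℓmem) (τ⁻¹ * g) with h | h
      · exfalso
        have : g (θ ℓ) = -θ ℓ := by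
          calc g (θ ℓ) = (τ * (τ⁻¹ * g)) (θ ℓ) := by rw [mul_inv_cancel_left]
            _ = -θ ℓ := by rw [AlgEquiv.mul_apply, h, hτθ]
        exact ne_neg_of_ne_zero hθ0 (hg.symm.trans this)
      · exact h
    have hsign : (∏ ℓ' ∈ ℓ.primeFactors, (if (τ⁻¹ * g) (θ ℓ') = θ ℓ' then (1 : ℤ) else -1)) = -1 := by
      rw [hPF, Finset.prod_singleton, if_neg]
      rw [hhθ]
      exact fun h ↦ ne_neg_of_ne_zero hθ0 h.symm
    calc pointGalHom W (ringClassField K ι ℓ) g S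
        = pointGalHom W (ringClassField K ι ℓ) (τ * (τ⁻¹ * g)) S := by rw [mul_inv_cancel_left]
      _ = S := by rw [pointGalHom_mul_apply, hS _ hh, hsign, neg_one_smul, map_neg, hSτ, neg_neg]

omit [NeZero (W.conductorNorm ℤ)] in
/-- **DESCENT TO THE AUXILIARY FIELD**: on the crux's frame at a Kolyvagin prime `ℓ`, with `τ ∉ 𝒢_ℓ`, `τθ_ℓ = −θ_ℓ` and the
`τ`-fixed `χ_ℓ`-points torsion, every `χ_ℓ`-isotypic point `R ∈ E(K[ℓ])` (e.g. the genus point `Y_ℓ`, the reduced genus point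
`W_ℓ`, any of its `2`-power roots) has an ODD multiple `m·R` which is a `ℚ(θ_ℓ)`-rational point anti-fixed by `τ`:
`m·R ∈ E(K_ℓ)^−`, `K_ℓ = ℚ(√ℓ*)`. [cite: GrossLMS1991, §4 Lemma 4.3, §5] [cite: Cox2013, §9.A Lemma 9.3] -/
theorem heegner_isotypic_exists_odd_smul_mem_auxField [W.IsElliptic] [W.IsGloballyMinimal]
    (hK : IsImaginaryQuadratic K) (hodd : Odd (NumberField.discr K))
    (hH : SatisfiesHeegnerHypothesis (W.conductorNorm ℤ) K) (hsurj : W.HasSurjectiveModNGaloisRep ((2 : ℤ) ^ 1))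
    {ℓ : ℕ} (hℓ : ℓ.Prime) {θ : ℕ → ringClassField K ι ℓ}
    (hθ : ∀ ℓ' ∈ ℓ.primeFactors, θ ℓ' ^ 2 = algebraMap ℚ (ringClassField K ι ℓ) ((-1 : ℚ) ^ (ℓ' / 2) * ℓ'))
    {τ : ringClassField K ι ℓ ≃ₐ[ℚ] ringClassField K ι ℓ} (hτ : τ ∉ ringClassGal ι ℓ) (hτθ : τ (θ ℓ) = -θ ℓ)
    (hR0 : ∀ S : (W.baseChange (ringClassField K ι ℓ)).toAffine.Point,
      (∀ h ∈ ringClassGal ι ℓ, pointGalHom W (ringClassField K ι ℓ) h S =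
        (∏ ℓ' ∈ ℓ.primeFactors, (if h (θ ℓ') = θ ℓ' then (1 : ℤ) else -1)) • S) →
      pointGalHom W (ringClassField K ι ℓ) τ S = S → IsOfFinAddOrder S)
    {R : (W.baseChange (ringClassField K ι ℓ)).toAffine.Point}
    (hR : ∀ h ∈ ringClassGal ι ℓ, pointGalHom W (ringClassField K ι ℓ) h R =
      (∏ ℓ' ∈ ℓ.primeFactors, (if h (θ ℓ') = θ ℓ' then (1 : ℤ) else -1)) • R) :
    ∃ m : ℕ, Odd m ∧ pointGalHom W (ringClassField K ι ℓ) τ ((m : ℤ) • R) = -((m : ℤ) • R) ∧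
      ∀ g : ringClassField K ι ℓ ≃ₐ[ℚ] ringClassField K ι ℓ, g (θ ℓ) = θ ℓ →
        pointGalHom W (ringClassField K ι ℓ) g ((m : ℤ) • R) = (m : ℤ) • R := by
  obtain ⟨m, hm, hmτ⟩ := heegner_isotypic_exists_odd_smul_conj_eq_neg hK hodd hH hsurj hℓ.ne_zero hθ hτ hR0 hR
  have hmR : ∀ h ∈ ringClassGal ι ℓ, pointGalHom W (ringClassField K ι ℓ) h ((m : ℤ) • R) =
      (∏ ℓ' ∈ ℓ.primeFactors, (if h (θ ℓ') = θ ℓ' then (1 : ℤ) else -1)) • ((m : ℤ) • R) := fun h hh ↦ by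
    rw [map_zsmul, hR h hh, smul_comm]
  exact ⟨m, hm, hmτ, heegner_isotypic_fixed_of_apply_theta_eq hK hℓ hθ hτ hτθ hmR hmτ⟩

/-- **THE CERTIFICATE IN THE AUXILIARY FIELD.** On the crux's frame at a depth-2 Kolyvagin prime `ℓ` (`4 ∣ a_ℓ`), with `W_ℓ`
the reduced genus point (`2·W_ℓ = Y_ℓ`), `τ ∉ 𝒢_ℓ` with `τθ_ℓ = −θ_ℓ` (complex conjugation, §3) and the `τ`-fixed `χ_ℓ`-points
torsion (`rank E^{(ℓ*d_K)}(ℚ) = 0`): the crux's certificate clause `Σ_{g∈T} g·y(ℓ) ∉ 2E(K[ℓ])` holds **iff NO ODD multiple of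
`W_ℓ` is twice a `ℚ(θ_ℓ)`-RATIONAL point of `E(K[ℓ])`** — the `2`-primitivity of (the image of) `W_ℓ` in the `ℤ₂`-line
`E(K_ℓ) ⊗ ℤ₂`, `K_ℓ = ℚ(√ℓ*)`; by `heegner_isotypic_exists_odd_smul_mem_auxField` some odd multiple of `W_ℓ` does lie there,
so the condition is not vacuous. [cite: GrossLMS1991, §3 (3.5), Prop. 3.7 (1), §4 (4.1), Lemma 4.3, §5]
[cite: Cox2013, §9.A Lemma 9.3] [cite: McCallumLMS1991, §5] -/
theorem heegner_certificate_iff_forall_odd_not_two_dvd_in_auxField [W.IsElliptic] [W.IsGloballyMinimal]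
    (hK : IsImaginaryQuadratic K) (hodd : Odd (NumberField.discr K)) (h3 : NumberField.discr K ≠ -3)
    (hH : SatisfiesHeegnerHypothesis (W.conductorNorm ℤ) K) (hsurj : W.HasSurjectiveModNGaloisRep ((2 : ℤ) ^ 1))
    {ℓ : ℕ} (hℓ : ℓ.Prime) (hKoly : ∀ ℓ' ∈ ℓ.primeFactors, Zhang2014.IsKolyvaginPrime (W.conductorNorm ℤ) W K 2 ℓ')
    (hfour : ∀ ℓ' ∈ ℓ.primeFactors, (4 : ℤ) ∣ W.frobeniusTrace ℓ')
    (d : KolyvaginHeegnerData Dt β ι ℓ) {θ : ℕ → ringClassField K ι ℓ}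
    (hθ : ∀ ℓ' ∈ ℓ.primeFactors, θ ℓ' ^ 2 = algebraMap ℚ (ringClassField K ι ℓ) ((-1 : ℚ) ^ (ℓ' / 2) * ℓ'))
    (G : Finset (ringClassField K ι ℓ ≃ₐ[ℚ] ringClassField K ι ℓ)) (hG : ∀ g, g ∈ G ↔ g ∈ ringClassGal ι ℓ)
    (T : Finset (ringClassField K ι ℓ ≃ₐ[ℚ] ringClassField K ι ℓ))
    (hT : ∀ g, g ∈ T ↔ g ∈ ringClassGal ι ℓ ∧ ∀ ℓ' ∈ ℓ.primeFactors, g (θ ℓ') = θ ℓ')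
    {τ : ringClassField K ι ℓ ≃ₐ[ℚ] ringClassField K ι ℓ} (hτ : τ ∉ ringClassGal ι ℓ) (hτθ : τ (θ ℓ) = -θ ℓ)
    (hR0 : ∀ S : (W.baseChange (ringClassField K ι ℓ)).toAffine.Point,
      (∀ h ∈ ringClassGal ι ℓ, pointGalHom W (ringClassField K ι ℓ) h S =
        (∏ ℓ' ∈ ℓ.primeFactors, (if h (θ ℓ') = θ ℓ' then (1 : ℤ) else -1)) • S) →
      pointGalHom W (ringClassField K ι ℓ) τ S = S → IsOfFinAddOrder S)
    {Wn : (W.baseChange (ringClassField K ι ℓ)).toAffine.Point}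
    (hWn : ((2 : ℤ) ^ ℓ.primeFactors.card) • Wn =
      ∑ g ∈ G, (∏ ℓ' ∈ ℓ.primeFactors, (if g (θ ℓ') = θ ℓ' then (1 : ℤ) else -1)) •
        pointGalHom W (ringClassField K ι ℓ) g d.y) :
    (¬ ∃ Q : (W.baseChange (ringClassField K ι ℓ)).toAffine.Point, (2 : ℤ) • Q =
        ∑ g ∈ T, pointGalHom W (ringClassField K ι ℓ) g d.y) ↔
      ∀ m : ℕ, Odd m → ¬ ∃ Q : (W.baseChange (ringClassField K ι ℓ)).toAffine.Point,
        (∀ g : ringClassField K ι ℓ ≃ₐ[ℚ] ringClassField K ι ℓ, g (θ ℓ) = θ ℓ →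
          pointGalHom W (ringClassField K ι ℓ) g Q = Q) ∧ (2 : ℤ) • Q = (m : ℤ) • Wn := by
  have hsq : Squarefree ℓ := Irreducible.squarefree hℓ
  rw [heegner_certificate_iff_reducedGenusPoint_of_depth_two hK hodd h3 hH hsurj hsq hKoly hfour d hθ G hG T hT hWn]
  constructor
  · -- an odd multiple `m·W = 2Q` makes `W = 2(Q − k·W)`, `m = 2k+1`
    rintro hcert m ⟨k, hk⟩ ⟨Q, -, hQ⟩
    refine hcert ⟨Q - (k : ℤ) • Wn, ?_⟩
    have h2 : (2 : ℤ) • Q = (2 * (k : ℤ) + 1) • Wn := by rw [hQ, hk]; norm_cast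
    calc (2 : ℤ) • (Q - (k : ℤ) • Wn) = (2 : ℤ) • Q - (2 * (k : ℤ)) • Wn := by rw [smul_sub, smul_smul]
      _ = (2 * (k : ℤ) + 1) • Wn - (2 * (k : ℤ)) • Wn := by rw [h2]
      _ = Wn := by rw [← sub_smul, add_sub_cancel_left, one_smul]
  · -- a half `Q` of `W` is isotypic; an odd multiple of it is `ℚ(θ)`-rational and halves `m·W`
    rintro hno ⟨Q, hQ⟩
    have hQiso : ∀ h ∈ ringClassGal ι ℓ, pointGalHom W (ringClassField K ι ℓ) h Q =
        (∏ ℓ' ∈ ℓ.primeFactors, (if h (θ ℓ') = θ ℓ' then (1 : ℤ) else -1)) • Q := fun h hh ↦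
      heegner_reducedGenusPoint_half_isotypic hK hodd hH hsurj hℓ.ne_zero d hθ G hG hWn hQ hh
    obtain ⟨m, hm, -, hrat⟩ :=
      heegner_isotypic_exists_odd_smul_mem_auxField hK hodd hH hsurj hℓ hθ hτ hτθ hR0 hQiso
    exact hno m hm ⟨(m : ℤ) • Q, hrat, by rw [smul_comm, hQ]⟩

/-! ### §3 The hypotheses are met: complex conjugation moves `θ_ℓ = √ℓ*` (`ℓ* < 0` at depth 2), and such `τ` exist -/

/-- **Depth 2 forces `ℓ ≡ 3 (mod 4)`, so `ℓ* = −ℓ < 0`** (`4 ∣ ℓ + 1`; the radical `θ_ℓ = √ℓ*` is purely imaginary and the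
auxiliary field `ℚ(θ_ℓ) = ℚ(√−ℓ)` is imaginary quadratic of prime discriminant `−ℓ` when `ℓ > 3`). [folklore] -/
theorem pStar_eq_neg_of_four_dvd_succ {ℓ : ℕ} (h4 : 4 ∣ ℓ + 1) : ((-1 : ℚ) ^ (ℓ / 2) * ℓ) = -(ℓ : ℚ) := by
  obtain ⟨k, hk⟩ := h4
  have hodd : Odd (ℓ / 2) := ⟨k - 1, by omega⟩
  rw [hodd.neg_one_pow]
  ring

/-- **Complex conjugation moves a purely imaginary radical**: if `τ ∈ Aut(K[n]/ℚ)` acts as complex conjugation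
(`X11b.RingClassConj.exists_conj_algEquiv`) and `θ² = q` with `q < 0` rational, then `τθ = −θ`.  With
`pStar_eq_neg_of_four_dvd_succ` this supplies `hτθ` at every depth-2 Kolyvagin prime, and `conj_not_mem_ringClassGal` supplies
`hτ`. [folklore] -/
theorem heegner_conj_apply_eq_neg_of_sq_eq_neg {n : ℕ} {τ : ringClassField K ι n ≃ₐ[ℚ] ringClassField K ι n}
    (hτc : ∀ x : ringClassField K ι n, ((τ x : ringClassField K ι n) : ℂ) = starRingEnd ℂ x)
    {θ : ringClassField K ι n} {q : ℚ} (hθ2 : θ ^ 2 = algebraMap ℚ (ringClassField K ι n) q) (hq : q < 0) :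
    τ θ = -θ := by
  apply Subtype.ext
  rw [hτc, NegMemClass.coe_neg]
  set z : ℂ := ((θ : ringClassField K ι n) : ℂ) with hz
  -- `z² = q < 0`, hence `re z = 0` and `conj z = −z`
  have hz2 : z ^ 2 = (q : ℂ) := by
    have h := congrArg (fun x : ringClassField K ι n ↦ (x : ℂ)) hθ2
    rw [SubmonoidClass.coe_pow, eq_ratCast, SubfieldClass.coe_ratCast] at h
    exact h
  have hre : z.re * z.re - z.im * z.im = (q : ℝ) := by
    have h := congrArg Complex.re hz2
    rw [sq, Complex.mul_re, Complex.ratCast_re] at h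
    exact h
  have him : z.re * z.im + z.im * z.re = 0 := by
    have h := congrArg Complex.im hz2
    rw [sq, Complex.mul_im, Complex.ratCast_im] at h
    exact h
  have hre0 : z.re = 0 := by
    have h2 : z.re * z.im = 0 := by linarith
    rcases mul_eq_zero.mp h2 with h | h
    · exact h
    · exfalso
      rw [h, mul_zero, sub_zero] at hre
      have hq' : ((q : ℝ)) < 0 := by exact_mod_cast hq
      nlinarith [mul_self_nonneg z.re]
  apply Complex.ext
  · rw [Complex.conj_re, Complex.neg_re, hre0, neg_zero]
  · rw [Complex.conj_im, Complex.neg_im]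

/-- **Existence of `τ ∉ Gal(K[ℓ]/K)` with `τθ_ℓ = −θ_ℓ`** on the crux's frame at a Kolyvagin prime `ℓ` (no sign hypothesis on
`ℓ*`): take any `τ₁ ∉ 𝒢_ℓ` (Cox Lemma 9.3) and, if `τ₁θ = θ`, replace it by `τ₁σ_ℓ` (`σ_ℓθ = −θ`,
`heegner_genusRadicals_table`). So the hypotheses `hτ`, `hτθ` of §2 are always jointly satisfiable.
[cite: Cox2013, §9.A Lemma 9.3] [cite: GrossLMS1991, §3 (G_ℓ, σ_ℓ)] -/
theorem heegner_exists_not_mem_ringClassGal_apply_theta_eq_neg [W.IsGloballyMinimal] (hK : IsImaginaryQuadratic K)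
    {ℓ : ℕ} (hℓ : ℓ.Prime) (hKoly : ∀ ℓ' ∈ ℓ.primeFactors, Zhang2014.IsKolyvaginPrime (W.conductorNorm ℤ) W K 2 ℓ')
    (d : KolyvaginHeegnerData Dt β ι ℓ) {θ : ℕ → ringClassField K ι ℓ}
    (hθ : ∀ ℓ' ∈ ℓ.primeFactors, θ ℓ' ^ 2 = algebraMap ℚ (ringClassField K ι ℓ) ((-1 : ℚ) ^ (ℓ' / 2) * ℓ')) :
    ∃ τ : ringClassField K ι ℓ ≃ₐ[ℚ] ringClassField K ι ℓ, τ ∉ ringClassGal ι ℓ ∧ τ (θ ℓ) = -θ ℓ := by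
  have hℓmem : ℓ ∈ ℓ.primeFactors := by rw [Nat.Prime.primeFactors hℓ]; exact Finset.mem_singleton_self ℓ
  obtain ⟨τ₁, hτ₁, -⟩ := exists_not_mem_ringClassGal_forall_mul_mul_inv_eq_inv hK ι hℓ.ne_zero
  rcases algEquiv_apply_eq_or_eq_neg_of_sq_eq (hθ ℓ hℓmem) τ₁ with h | h
  · obtain ⟨-, hσ, -⟩ := heegner_genusRadicals_table hK (Irreducible.squarefree hℓ) hKoly d hθ ℓ hℓmem
    have hσmem : d.σ ℓ ∈ ringClassGal ι ℓ := by
      have := heegner_sigma_pow_mem hℓ d 1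
      rw [pow_one] at this
      exact ringClassGalOver_le_ringClassGal ι ℓ 1 this
    refine ⟨τ₁ * d.σ ℓ, fun hmem ↦ hτ₁ ?_, ?_⟩
    · have := mul_mem hmem (inv_mem hσmem)
      rwa [mul_inv_cancel_right] at this
    · rw [AlgEquiv.mul_apply, hσ, map_neg, h]
  · exact ⟨τ₁, hτ₁, h⟩

end Heegner

end Summit.BirchSwinnertonDyer.BirchSwinnertonDyer.Theorems.GenusKoly

end
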